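import Summits.HodgeConjecture.HodgeConjecture.Theorems.EndoscopicMiddleDegreeOrthogonalEnvelopedOfBetAlone
import Summits.HodgeConjecture.HodgeConjecture.Theorems.EndoscopicMiddleDegreeAlgebraicOrEnvelopedStubHeckeGraphAlgebraic
import Literature.AlgebraicGeometry.HodgeTheory.ArapuraSurfaceFibredFourfoldsProofs
import HarnessLib

/-!
# `AlgebraicOrEnveloped` from the Hodge conjecture on Hecke cores ALONE
# (crux `EndoscopicMiddleDegree.AlgebraicOrEnveloped`, stmt-HodgeConjecture-14943, line `core-splitting-ladder`, lead seat c4, rev 8)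

The crux (rank 5, THE DICHOTOMY): for `m ∈ {1,2}` (`n = m + 1`), a datum `D : UnitaryBallQuotientDatum (2n) X` and HC in
degree `2m` on `X`, every rational Hodge `(n,n)`-class `c` lies in
`algebraicClasses X n ⊔ span {e rational | ∃ μ γ, P_γ rational-preserving, (n,n)-valued, P_γ e = e}`.

This file makes the registered skeleton of line `core-splitting-ladder` ONE stub: the crux follows from THE BET
`stub_coreHodgeClassesAlgebraic` (HC for the classes `ε e` of Hecke CORES; hypothesis `hCore` below, VERBATIM the registered
signature) and NOTHING ELSE — no `CupProductAlgebraic` (route item stmt-HodgeConjecture-14350), no coniveau remark, no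
Hodge–Riemann split. Compare the rev-5/7 composition `…OfCoreHodgeClassesAlgebraic.algebraicOrEnveloped_of_coreHodgeClassesAlgebraic`
(p117869: `Grothendieck1969 → CupProductAlgebraic → bet → crux`) and its pure-case refinement (p118246): both route the bet through
the dead line's glue "envelope the `Alg`-orthogonal remainder" (p106212), which is the only reason cup products (cup-adjoint closure of
the Hecke algebra, `P_γ(Alg) ⊆ Alg`, `Alg ∩ Alg^⊥ ∩ Hdg_ℚ = 0`) were ever needed.

PROOF (direct block decomposition). Let `s` be the ℚ-blocks of the Hecke algebra `𝓗 = Algebra.adjoin ℂ (range T_g)` on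
`H²ⁿ(X(ℂ); ℂ)` (`stub_rationalBlocks`, p87916: in `𝓗`, idempotent, central, rational-preserving, primitive among such, `Σ ε = 1`).
Then `c = Σ_ε ε c`, and blockwise:
* a PURE block (`ε β` is `(n,n)` for every `β`): `ε c` is ENVELOPED by `γ_ε` itself — every element of `𝓗` is the action `P_γ` of an
  ALGEBRAIC class `γ` on `X ⊗ X` (the Hecke ring `adjoin_hecke_le_span`, p-landed on 14300, + `stub_heckeGraphAlgebraic` p112869 +
  linearity of `γ ↦ P_γ`), `P_{γ_ε} = ε` preserves rational classes, is `(n,n)`-valued by purity, and fixes `ε c` by idempotency;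
* a KILLED impure block: `ε c = 0` by the coefficient-conjugation sieve (`stub_killedBarren` p96373, fed the UNCONDITIONAL Hodge-type
  stability of the Hecke algebra `heckeHodgeType`);
* an UN-KILLED impure block — a CORE: `ε c ∈ algebraicClasses X n` by the bet.
The orientation family demanded by the crux is the complex one (the tree's `exists_orientationFamily_hasPoincareDuality`:
`Motives.ComplexPoints.isOrientableOver` + `OrientationFamily.hasPoincareDuality`), supplied here under Theorems/ as the route intends.

NOT here: any attack on the bet (HC-strength: implied by the route's target `MiddleDegreeStep`, p117875; refutable only by ¬HC,
Disproof F1), any restatement of the crux, any definition.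

References: BMM arXiv:1306.1515 Part 2 §1.8–1.9, Thm. 61; Arancibia–Moeglin–Renard arXiv:1507.01432 §8; Shimura 1971 §3.1.
-/

noncomputable section
set_option linter.dupNamespace false -- `Summit.<P>.<Sub>.Theorems.…` repeats `HodgeConjecture` (single-conjunct summit)

namespace Summit.HodgeConjecture.HodgeConjecture.Theorems.CoreSplittingLadder

open scoped BigOperators
open CategoryTheory MonoidalCategory CartesianMonoidalCategory
open Literature.AlgebraicGeometry.Motives (SchemeOver ComplexPoints IsSmoothProjective)
open Literature.AlgebraicGeometry.HodgeTheory
open Literature.AlgebraicGeometry.ShimuraVarieties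
open Literature.AlgebraicTopology.SingularHomology
open Summit.HodgeConjecture.HodgeConjecture.Theses.EndoscopicMiddleDegree (AlgebraicOrEnveloped)
open Summit.HodgeConjecture.HodgeConjecture.Cruxes.MiddleThetaSpan.ConjugateDimensionSieve (IsPrimitiveCentralIdempotent)
open Summit.HodgeConjecture.HodgeConjecture.Cruxes.OrthogonalEnveloped.ImpureBarrenEnvelope (stub_rationalBlocks)
open Summit.HodgeConjecture.HodgeConjecture.Cruxes.OrthogonalEnveloped.PuritySortedHeckeEnvelope
  (stub_killedBarren heckeHodgeType adjoin_hecke_le_span)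

/-- **Every element of the Hecke algebra is the action of an ALGEBRAIC self-correspondence** (no cup products): the Hecke algebra is
the span of the `T_g` (`adjoin_hecke_le_span`, the Hecke ring), each `T_g` is the action of an algebraic class (`stub_heckeGraphAlgebraic`,
p112869: BMM Thm. 61 / Shimura §7.2 on the tree's carriers), and `γ ↦ P_γ` is linear.
[cite: BergeronMillsonMoeglin2016Balls, Part 2 §1.8 and Thm. 61] [cite: Shimura1971, §3.1] -/
theorem exists_algebraic_corrAction_eq_of_mem_adjoin {μ : OrientationFamily} (hμ : μ.HasPoincareDuality)
    {m : ℕ} {X : SchemeOver ℂ} (D : UnitaryBallQuotientDatum (2 * (m + 1)) X) (hm1 : 1 ≤ m) (hm2 : m ≤ 2)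
    {a : Module.End ℂ (complexBetti X (2 * (m + 1)))}
    (ha : a ∈ Algebra.adjoin ℂ (Set.range (D.heckeCorrespondenceAction (2 * (m + 1))))) :
    ∃ γ ∈ algebraicClasses (X ⊗ X) (2 * (m + 1)),
      corrAction μ D.isSmoothProjective D.isSmoothProjective
        (rfl : 2 * (m + 1) + 2 * (2 * (m + 1)) = 2 * (m + 1) + 2 * (2 * (m + 1))) γ = a := by
  have ha' := adjoin_hecke_le_span D _ ha
  clear ha
  induction ha' using Submodule.span_induction with
  | mem T hT =>
    obtain ⟨g, rfl⟩ := hT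
    exact stub_heckeGraphAlgebraic μ hμ m X D hm1 hm2 g
  | zero => exact ⟨0, zero_mem _, map_zero _⟩
  | add a b _ _ iha ihb =>
    obtain ⟨γ, hγ, rfl⟩ := iha
    obtain ⟨γ', hγ', rfl⟩ := ihb
    exact ⟨γ + γ', add_mem hγ hγ', map_add _ _ _⟩
  | smul r a _ iha =>
    obtain ⟨γ, hγ, rfl⟩ := iha
    exact ⟨r • γ, Submodule.smul_mem _ r hγ, map_smul _ _ _⟩

/-- **THE CRUX AT ONE DATUM, GRANTED HC ON ITS HECKE CORES** (pointwise form; no `hlow`, no cup products, no named fact). For a datum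
`D` (`m ∈ {1,2}`, `n = m + 1`) such that every CORE `ε` of the Hecke algebra on `H²ⁿ(X(ℂ); ℂ)` — a ℚ-block (in the algebra, idempotent,
central, rational-preserving, Hodge-type-preserving, primitive among the rational central idempotents) that is IMPURE and UN-KILLED by
the coefficient-conjugation sieve — maps every rational `(n,n)`-class into `algebraicClasses X n`, every rational `(n,n)`-class `c` lies in
`algebraicClasses X n ⊔ span {enveloped}`: `c = Σ_ε ε c` over the ℚ-blocks; pure blocks self-envelope (`P_{γ_ε} = ε`, idempotent),
killed blocks vanish on `c` (sieve), cores land in `Alg` (hypothesis). [cite: BergeronMillsonMoeglin2016Balls, Part 2 §1.9 and Thm. 61]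
[cite: ArancibiaMoeglinRenard2015, §8] -/
theorem mem_algebraic_sup_enveloped_of_cores {m : ℕ} {X : SchemeOver ℂ} (D : UnitaryBallQuotientDatum (2 * (m + 1)) X)
    (hm1 : 1 ≤ m) (hm2 : m ≤ 2)
    (hCore : ∀ ε : Module.End ℂ (complexBetti X (2 * (m + 1))),
        ε ∈ Algebra.adjoin ℂ (Set.range (D.heckeCorrespondenceAction (2 * (m + 1)))) →
        ε * ε = ε →
        (∀ T ∈ Algebra.adjoin ℂ (Set.range (D.heckeCorrespondenceAction (2 * (m + 1)))),
          T * ε = ε * T) →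
        (∀ β, IsRationalClass β → IsRationalClass (ε β)) →
        (∀ (p q : ℕ) (x : complexBetti X (2 * (m + 1))), IsOfHodgeType (2 * (m + 1)) X (2 * (m + 1)) p q x →
          IsOfHodgeType (2 * (m + 1)) X (2 * (m + 1)) p q (ε x)) →
        (∀ f ∈ Algebra.adjoin ℂ (Set.range (D.heckeCorrespondenceAction (2 * (m + 1)))),
          f * f = f →
          (∀ T ∈ Algebra.adjoin ℂ (Set.range (D.heckeCorrespondenceAction (2 * (m + 1)))),
            T * f = f * T) →
          (∀ β, IsRationalClass β → IsRationalClass (f β)) → f * ε = 0 ∨ f * ε = ε) →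
        (∃ β, ¬ IsOfHodgeType (2 * (m + 1)) X (2 * (m + 1)) (m + 1) (m + 1) (ε β)) →
        (∃ z : Module.End ℂ (complexBetti X (2 * (m + 1))),
          IsPrimitiveCentralIdempotent
              (Algebra.adjoin ℂ (Set.range (D.heckeCorrespondenceAction (2 * (m + 1))))) z ∧
            z * ε = z ∧
              ∀ σ : ℂ ≃+* ℂ, ∃ c : complexBetti X (2 * (m + 1)),
                IsOfHodgeType (2 * (m + 1)) X (2 * (m + 1)) (m + 1) (m + 1) (conjEnd σ z c) ∧
                  conjEnd σ z c ≠ 0) →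
        ∀ e : complexBetti X (2 * (m + 1)), IsRationalClass e →
          IsOfHodgeType (2 * (m + 1)) X (2 * (m + 1)) (m + 1) (m + 1) e →
          ε e ∈ algebraicClasses X (m + 1))
    (c : complexBetti X (2 * (m + 1))) (hc : IsRationalClass c)
    (hH : IsOfHodgeType (2 * (m + 1)) X (2 * (m + 1)) (m + 1) (m + 1) c) :
    c ∈ algebraicClasses X (m + 1) ⊔ Submodule.span ℂ {e : complexBetti X (2 * (m + 1)) | IsRationalClass e ∧
      ∃ μ : OrientationFamily, μ.HasPoincareDuality ∧ ∃ γ ∈ algebraicClasses (X ⊗ X) (2 * (m + 1)),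
        let P : complexBetti X (2 * (m + 1)) → complexBetti X (2 * (m + 1)) := fun β =>
          complexGysin μ (IsSmoothProjective.tensor_holds D.isSmoothProjective D.isSmoothProjective)
            D.isSmoothProjective (fst X X)
            (show 2 * (m + 1) + 2 * (2 * (m + 1)) + 2 * (2 * (m + 1)) = 2 * (m + 1) + 2 * (2 * (m + 1) + 2 * (m + 1)) by ring)
            (cupProduct (rfl : 2 * (m + 1) + 2 * (2 * (m + 1)) = 2 * (m + 1) + 2 * (2 * (m + 1)))
              (complexBetti.map (snd X X) (2 * (m + 1)) β) γ);
        (∀ β, IsRationalClass β → IsRationalClass (P β)) ∧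
          (∀ β, IsOfHodgeType (2 * (m + 1)) X (2 * (m + 1)) (m + 1) (m + 1) (P β)) ∧ P e = e} := by
  classical
  obtain ⟨μ, hμ⟩ := exists_orientationFamily_hasPoincareDuality
  -- the ℚ-blocks of the Hecke algebra (landed, p87916)
  obtain ⟨s, hblk, -, hsum⟩ := stub_rationalBlocks m X D hm1 hm2
  -- each block is the action of an ALGEBRAIC class
  have hεS : ∀ ε ∈ s, ∃ γ ∈ algebraicClasses (X ⊗ X) (2 * (m + 1)),
      corrAction μ D.isSmoothProjective D.isSmoothProjective
        (rfl : 2 * (m + 1) + 2 * (2 * (m + 1)) = 2 * (m + 1) + 2 * (2 * (m + 1))) γ = ε :=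
    fun ε hε ↦ exists_algebraic_corrAction_eq_of_mem_adjoin hμ D hm1 hm2 (hblk ε hε).1
  choose! γf hγf hPγ using hεS
  -- `c = Σ_ε ε c`
  have hc_sum : c = ∑ ε ∈ s, ε c := by
    conv_lhs => rw [show c = (∑ ε ∈ s, ε) c by rw [hsum]; rfl]
    rw [LinearMap.sum_apply]
  rw [hc_sum]
  refine Submodule.sum_mem _ fun ε hε ↦ ?_
  obtain ⟨h1, h2, h3, h4, h5⟩ := hblk ε hε
  by_cases hpure : ∀ β, IsOfHodgeType (2 * (m + 1)) X (2 * (m + 1)) (m + 1) (m + 1) (ε β)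
  · -- a PURE block: `ε c` is enveloped by `γ_ε` itself
    refine Submodule.mem_sup_right (Submodule.subset_span ⟨h4 c hc, μ, hμ, γf ε, hγf ε hε, ?_⟩)
    intro P
    have hPβ : ∀ β, P β = ε β := fun β ↦ by
      change corrAction μ D.isSmoothProjective D.isSmoothProjective
        (rfl : 2 * (m + 1) + 2 * (2 * (m + 1)) = 2 * (m + 1) + 2 * (2 * (m + 1))) (γf ε) β = _
      rw [hPγ ε hε]
    refine ⟨fun β hβ ↦ ?_, fun β ↦ ?_, ?_⟩
    · rw [hPβ]; exact h4 β hβ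
    · rw [hPβ]; exact hpure β
    · rw [hPβ, ← Module.End.mul_apply, h2]
  · -- an IMPURE block: killed (sieve) or a core (the bet) — either way `ε c` is algebraic
    refine Submodule.mem_sup_left ?_
    by_cases hK : ∀ z : Module.End ℂ (complexBetti X (2 * (m + 1))),
        IsPrimitiveCentralIdempotent
            (Algebra.adjoin ℂ (Set.range (D.heckeCorrespondenceAction (2 * (m + 1))))) z →
          z * ε = z →
            ∃ σ : ℂ ≃+* ℂ, ∀ c : complexBetti X (2 * (m + 1)),
              IsOfHodgeType (2 * (m + 1)) X (2 * (m + 1)) (m + 1) (m + 1) (conjEnd σ z c) →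
                conjEnd σ z c = 0
    · -- (K) a KILLED block: `ε c = 0` by the sieve, fed the unconditional `heckeHodgeType`
      rw [stub_killedBarren m X D hm1 hm2 (fun a ha x hx ↦ heckeHodgeType D ha x hx) ε h1 h2 h3 hK c hc hH]
      exact zero_mem _
    · -- (C) a CORE: `ε c ∈ Alg` by the bet
      push Not at hK
      exact hCore ε h1 h2 h3 h4 (fun p q x hx ↦ heckeHodgeType D h1 x hx) h5 (not_forall.1 hpure) hK c hc hH

/-- **`AlgebraicOrEnveloped` GRANTED THE BET ALONE.** The hypothesis is VERBATIM the registered stub `stub_coreHodgeClassesAlgebraic`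
of line `core-splitting-ladder` (HC for the classes `ε e` of Hecke cores, with the crux's free hypothesis `hlow` = HC in degree `2m`
handed to it); the conclusion is the crux BY NAME. No `CupProductAlgebraic`, no coniveau remark, no Hodge–Riemann: the route item
stmt-HodgeConjecture-14350 is OFF this crux's path. [cite: BergeronMillsonMoeglin2016Balls, Part 2 §1.9 and Thm. 61]
[cite: ArancibiaMoeglinRenard2015, §8] -/
theorem algebraicOrEnveloped_of_bet :
    (∀ (m : ℕ) (X : SchemeOver ℂ) (D : UnitaryBallQuotientDatum (2 * (m + 1)) X), 1 ≤ m → m ≤ 2 →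
      (∀ a : complexBetti X (2 * m), IsRationalClass a →
        IsOfHodgeType (2 * (m + 1)) X (2 * m) m m a → a ∈ algebraicClasses X m) →
      ∀ ε : Module.End ℂ (complexBetti X (2 * (m + 1))),
        ε ∈ Algebra.adjoin ℂ (Set.range (D.heckeCorrespondenceAction (2 * (m + 1)))) →
        ε * ε = ε →
        (∀ T ∈ Algebra.adjoin ℂ (Set.range (D.heckeCorrespondenceAction (2 * (m + 1)))),
          T * ε = ε * T) →
        (∀ β, IsRationalClass β → IsRationalClass (ε β)) →
        (∀ (p q : ℕ) (x : complexBetti X (2 * (m + 1))), IsOfHodgeType (2 * (m + 1)) X (2 * (m + 1)) p q x →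
          IsOfHodgeType (2 * (m + 1)) X (2 * (m + 1)) p q (ε x)) →
        (∀ f ∈ Algebra.adjoin ℂ (Set.range (D.heckeCorrespondenceAction (2 * (m + 1)))),
          f * f = f →
          (∀ T ∈ Algebra.adjoin ℂ (Set.range (D.heckeCorrespondenceAction (2 * (m + 1)))),
            T * f = f * T) →
          (∀ β, IsRationalClass β → IsRationalClass (f β)) → f * ε = 0 ∨ f * ε = ε) →
        (∃ β, ¬ IsOfHodgeType (2 * (m + 1)) X (2 * (m + 1)) (m + 1) (m + 1) (ε β)) →
        (∃ z : Module.End ℂ (complexBetti X (2 * (m + 1))),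
          IsPrimitiveCentralIdempotent
              (Algebra.adjoin ℂ (Set.range (D.heckeCorrespondenceAction (2 * (m + 1))))) z ∧
            z * ε = z ∧
              ∀ σ : ℂ ≃+* ℂ, ∃ c : complexBetti X (2 * (m + 1)),
                IsOfHodgeType (2 * (m + 1)) X (2 * (m + 1)) (m + 1) (m + 1) (conjEnd σ z c) ∧
                  conjEnd σ z c ≠ 0) →
        ∀ e : complexBetti X (2 * (m + 1)), IsRationalClass e →
          IsOfHodgeType (2 * (m + 1)) X (2 * (m + 1)) (m + 1) (m + 1) e →
          ε e ∈ algebraicClasses X (m + 1)) →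
    AlgebraicOrEnveloped :=
  fun hCore m X D hm1 hm2 hlow c hc hH ↦ mem_algebraic_sup_enveloped_of_cores D hm1 hm2 (hCore m X D hm1 hm2 hlow) c hc hH

end Summit.HodgeConjecture.HodgeConjecture.Theorems.CoreSplittingLadder

end
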